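import Literature.Probability.RandomPlanarGeometry.SAWCountMonotoneEscape
import HarnessLib

/-!
# Monotonicity `cₙ ≤ cₙ₊₁` (O'Brien 1990): certificates on the escape residual

Sequel of `SAWCountMonotoneEscape.lean` (the escape injection `escapeMap`: prolong a free end along an
escape route, prepend a free start site to a doomed end; injective on the `n`-step walks outside the
residual `R = escapeResidual d n` = doomed end and completely surrounded start, whence `cₙ ≤ cₙ₊₁ + #R`).
The `(n+1)`-step walks NOT hit by the escape injection are spare; O'Brien's inequality follows as soon as
the residual walks can be distributed over spare walks, one unit each, no spare walk receiving more than
one unit in total.  This is the analogue, for the escape route, of `SAWCountMonotoneFractional.lean` /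
`SAWCountMonotoneSelfAdjusting.lean` for the reversal route — with a source set that is `3–10×` smaller on
`ℤ²` (`#R = 0, …, 0, 8, 16, 112, 176, 1080, 1592` against `#T₂ = 8, 8, 80, 80, 616, 712, 4384, 5832` for
`n = 9, …, 16`; lane enumeration, not used in proofs).

* `count_le_count_succ_of_escape_fractional` : **`cₙ ≤ cₙ₊₁`** from rational masses
  `W : R × 𝒲ₙ₊₁ → ℚ` with row sums `1`, column sums `≤ 1`, and no mass on the image of the escape injection;
* `count_le_count_succ_of_escape_selfAdjusting` : the receiver-normalised form — for any relation `Rel`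
  from `R` to `(n+1)`-step walks, if every `ω ∈ R` has `Σ_{η spare, Rel ω η} 1 / indeg η ≥ 1`
  (`indeg η = #{ω' ∈ R : Rel ω' η}`), then `cₙ ≤ cₙ₊₁`.

[cite: MadrasSlade1993, §1.1, §7.1 p. 231] [cite: BDGS2012, §1.3 (`cₙ ≤ cₙ₊₁`, O'Brien 1990)]
-/

noncomputable section

open Literature.Probability.LatticeModels Literature.Probability.Percolation SimpleGraph
open scoped BigOperators

namespace Literature.Probability.RandomPlanarGeometry.SAW.Zd

variable {d : ℕ}

open Classical in
/-- The `(n+1)`-step walks USED by the escape injection: the image of the `n`-step self-avoiding walks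
outside the residual. [cite: BDGS2012, §1.3] -/
def escapeImage (d n : ℕ) : Finset (ℕ → Site d) :=
  ((saws d n).filter fun ω => ω ∉ escapeResidual d n).image (escapeMap n)

open Classical in
/-- The escape image lies in the `(n+1)`-step self-avoiding walks. [cite: BDGS2012, §1.3] -/
theorem escapeImage_subset (d n : ℕ) : escapeImage d n ⊆ saws d (n + 1) := by
  intro η hη
  obtain ⟨ω, hω, rfl⟩ := Finset.mem_image.1 hη
  obtain ⟨hs, hR⟩ := Finset.mem_filter.1 hω
  exact escapeMap_mem_saws hs hR

open Classical in
/-- The escape image has as many elements as there are walks outside the residual (injectivity).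
[cite: BDGS2012, §1.3] -/
theorem card_escapeImage (d n : ℕ) :
    (escapeImage d n).card = ((saws d n).filter fun ω => ω ∉ escapeResidual d n).card :=
  Finset.card_image_of_injOn (escapeMap_injOn d n)

open Classical in
/-- `#𝒲ₙ = #(walks outside R) + #R`. [cite: BDGS2012, §1.3] -/
theorem card_saws_eq_card_not_add_card_escapeResidual (d n : ℕ) :
    (saws d n).card = ((saws d n).filter fun ω => ω ∉ escapeResidual d n).card + (escapeResidual d n).card := by
  have hsplit := (Finset.card_filter_add_card_filter_not (s := saws d n) (fun ω => ω ∉ escapeResidual d n)).symm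
  have hR : ((saws d n).filter fun ω => ¬ (ω ∉ escapeResidual d n)) = escapeResidual d n := by
    ext ω
    simp only [Finset.mem_filter, not_not]
    exact ⟨fun h => h.2, fun h => ⟨(mem_escapeResidual.1 h).1, h⟩⟩
  rw [hR] at hsplit
  exact hsplit

open Classical in
/-- **O'Brien's inequality from a fractional certificate on the escape residual.** Let `W` assign to
each residual walk `ω ∈ R` a unit of (signed) mass spread over `(n+1)`-step self-avoiding walks, with no
walk receiving more than one unit in total and the walks used by the escape injection receiving nothing.
Then `cₙ ≤ cₙ₊₁` (count: `#R = Σ rows = Σ columns ≤ #(𝒲ₙ₊₁ \ image)`). [cite: BDGS2012, §1.3] -/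
theorem count_le_count_succ_of_escape_fractional {n : ℕ} (W : (ℕ → Site d) → (ℕ → Site d) → ℚ)
    (hrow : ∀ ω ∈ escapeResidual d n, ∑ η ∈ saws d (n + 1), W ω η = 1)
    (hcol : ∀ η ∈ saws d (n + 1), ∑ ω ∈ escapeResidual d n, W ω η ≤ 1)
    (hspare : ∀ η ∈ escapeImage d n, ∑ ω ∈ escapeResidual d n, W ω η = 0) :
    count d n ≤ count d (n + 1) := by
  classical
  set R := escapeResidual d n with hRdef
  set T := saws d (n + 1) with hT
  set I := escapeImage d n with hI
  have hIT : I ⊆ T := escapeImage_subset d n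
  -- `#R = Σ_η col η`, and the columns vanish on `I` and are `≤ 1` elsewhere
  have hRsum : ((R.card : ℕ) : ℚ) = ∑ η ∈ T, ∑ ω ∈ R, W ω η := by
    rw [Finset.sum_comm, Finset.card_eq_sum_ones, Nat.cast_sum]
    refine Finset.sum_congr rfl fun ω hω => ?_
    rw [hrow ω hω]; simp
  have hcols : ∑ η ∈ T, ∑ ω ∈ R, W ω η ≤ ((T \ I).card : ℚ) := by
    rw [← Finset.sum_sdiff hIT]
    have h1 : ∑ η ∈ I, ∑ ω ∈ R, W ω η = 0 := Finset.sum_eq_zero fun η hη => hspare η hη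
    rw [h1, add_zero, Finset.card_eq_sum_ones, Nat.cast_sum]
    refine Finset.sum_le_sum fun η hη => ?_
    simp only [Nat.cast_one]
    exact hcol η (Finset.mem_sdiff.1 hη).1
  have hcard : (T \ I).card + I.card = T.card := Finset.card_sdiff_add_card_eq_card hIT
  have key : R.card + I.card ≤ T.card := by
    have h' : ((R.card : ℕ) : ℚ) ≤ (((T \ I).card : ℕ) : ℚ) := by rw [hRsum]; exact hcols
    have := (Nat.cast_le (α := ℚ)).1 h'
    omega
  rw [← card_saws, ← card_saws, card_saws_eq_card_not_add_card_escapeResidual, ← card_escapeImage]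
  change I.card + R.card ≤ T.card
  omega

open Classical in
/-- **Receiver-normalised (self-adjusting) certificate on the escape residual.** For a relation `Rel`
from residual walks to `(n+1)`-step walks, let `indeg η = #{ω ∈ R : Rel ω η}` and call `η` spare if it
is a self-avoiding `(n+1)`-step walk outside the escape image. If every `ω ∈ R` satisfies
`Σ_{η spare, Rel ω η} 1 / indeg η ≥ 1`, then `cₙ ≤ cₙ₊₁`. [cite: BDGS2012, §1.3] -/
theorem count_le_count_succ_of_escape_selfAdjusting {n : ℕ} (Rel : (ℕ → Site d) → (ℕ → Site d) → Prop)
    (hZ : ∀ ω ∈ escapeResidual d n,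
      (1 : ℚ) ≤ ∑ η ∈ (saws d (n + 1)).filter (fun η => Rel ω η ∧ η ∉ escapeImage d n),
        (1 : ℚ) / ((escapeResidual d n).filter (fun ω' => Rel ω' η)).card) :
    count d n ≤ count d (n + 1) := by
  classical
  set R := escapeResidual d n with hRdef
  set indeg : (ℕ → Site d) → ℕ := fun η => (R.filter (fun ω' => Rel ω' η)).card with hindeg
  set Z : (ℕ → Site d) → ℚ :=
    fun ω => ∑ η ∈ (saws d (n + 1)).filter (fun η => Rel ω η ∧ η ∉ escapeImage d n), (1 : ℚ) / indeg η
    with hZdef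
  have hZ1 : ∀ ω ∈ R, 1 ≤ Z ω := fun ω hω => hZ ω hω
  set W : (ℕ → Site d) → (ℕ → Site d) → ℚ := fun ω η =>
    if ω ∈ R ∧ η ∈ saws d (n + 1) ∧ Rel ω η ∧ η ∉ escapeImage d n then ((1 : ℚ) / indeg η) / Z ω else 0
    with hW
  refine count_le_count_succ_of_escape_fractional W (fun ω hω => ?_) (fun η hη => ?_) (fun η hη => ?_)
  · -- rows
    have hZpos : 0 < Z ω := lt_of_lt_of_le zero_lt_one (hZ1 ω hω)
    have : ∑ η ∈ saws d (n + 1), W ω η =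
        ∑ η ∈ (saws d (n + 1)).filter (fun η => Rel ω η ∧ η ∉ escapeImage d n), ((1 : ℚ) / indeg η) / Z ω := by
      rw [Finset.sum_filter]
      refine Finset.sum_congr rfl fun η hη' => ?_
      by_cases hc : Rel ω η ∧ η ∉ escapeImage d n
      · rw [if_pos hc]; simp only [hW]; rw [if_pos ⟨hω, hη', hc.1, hc.2⟩]
      · rw [if_neg hc]; simp only [hW]; rw [if_neg (fun h => hc ⟨h.2.2.1, h.2.2.2⟩)]
    rw [this, ← Finset.sum_div, div_self hZpos.ne']
  · -- columns `≤ 1`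
    have h1 : ∑ ω ∈ R, W ω η = ∑ ω ∈ R.filter (fun ω' => Rel ω' η), W ω η := by
      rw [Finset.sum_filter]
      refine Finset.sum_congr rfl fun ω hω => ?_
      by_cases hc : Rel ω η
      · rw [if_pos hc]
      · rw [if_neg hc]; simp only [hW]; rw [if_neg (fun h => hc h.2.2.1)]
    have h2 : ∀ ω ∈ R.filter (fun ω' => Rel ω' η), W ω η ≤ (1 : ℚ) / indeg η := by
      intro ω hω
      have hωR := (Finset.mem_filter.1 hω).1
      simp only [hW]
      split_ifs with h
      · exact div_le_self (by positivity) (hZ1 ω hωR)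
      · positivity
    rw [h1]
    refine (Finset.sum_le_sum h2).trans ?_
    rw [Finset.sum_const, nsmul_eq_mul]
    simp only [hindeg]
    by_cases h0 : (R.filter (fun ω' => Rel ω' η)).card = 0
    · rw [h0]; simp
    · rw [mul_one_div, div_self]
      exact_mod_cast h0
  · -- no mass on the escape image
    refine Finset.sum_eq_zero fun ω hω => ?_
    simp only [hW]
    split_ifs with h
    · exact absurd hη h.2.2.2
    · rfl

end Literature.Probability.RandomPlanarGeometry.SAW.Zd
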